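import Literature.Barriers.RiemannHypothesis.EpsteinZetaStarkSetup
import Literature.NumberTheory.LFunctions.ZetaArgVariation
import Literature.Analysis.SpecialFunctions.DigammaVerticalSeries
import HarnessLib

/-!
# Stark's theorem on the zeros of Epstein zeta functions, II: the argument of `f(½ + it)` and the choice of the height `T₀` (Stark's Lemma 3)

Fifth proof file next to `Literature/Barriers/RiemannHypothesis/EpsteinZetaRealZeros.lean`.
Stark (§2: "we use the branch of `arg f(s)` which is `0` for real `s > ½`"; §4:
"`arg f(½ + i0⁺) = −π/2`") works with a continuous argument of `f(s) = (k/π)^sΓ(s)ζ(2s)` on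
`σ ≥ ½`. Here the branch is made explicit: writing `f(½ + it) = k^{½+it} ξ(1 + 2it)/((½ + it)(2it))`
(`Λ(w) = 2ξ(w)/(w(w−1))`) and using that `ξ` is zero-free on `Re w ≥ 1`,

  `θ_k(t) := t log k + ϑ_ξ(2t) − arg(½ + it) − π/2`,   `ϑ_ξ(V) := ∫₀^V Re (ξ'/ξ)(1 + iu) du`

(`Literature.Barriers.RiemannHypothesis.starkTheta`, `Literature.Barriers.RiemannHypothesis.xiArg`)
is a continuous function of `t ≥ 0` with `θ_k(0) = −π/2` and **`f(½ + it) = |f(½ + it)| e^{iθ_k(t)}`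
for `t > 0`** (`Literature.Barriers.RiemannHypothesis.starkF_critical_eq_norm_mul_exp`).

Main results:

* `Literature.Barriers.RiemannHypothesis.starkTheta_sub_ge` — **the increase of `θ_k`** (replacing
  Stark's Lemma 2–3, which bound `Re f'/f > log k` pointwise using Vinogradov's estimates): for
  `2 ≤ T₁ ≤ T₂`,
  `θ_k(T₂) − θ_k(T₁) ≥ (T₂ − T₁)(log k − 16/5) − π/2 − 3π − 2π log(120(2T₂ + 4))/log(7/6)`;
  the `Γ`-factor contributes `≥ −1.6` per unit (`Re ψ(x + iu) ≥ ψ(x)`, the series of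
  Andrews–Askey–Roy (1.2.13)), and the variation of `arg ζ(1 + iv)` over `[2T₁, 2T₂]` is
  `O(log T₂)` by Backlund's lemma on `[1, 2] × {2Tᵢ}` and Cauchy's theorem on `[1,2] × [2T₁, 2T₂]`
  (the tree's `S(T) = O(log T)` machinery, `ZetaArgVariation.lean`);
* `Literature.Barriers.RiemannHypothesis.exists_starkT₀` — hence, when
  `50(log k − 16/5) ≥ 2π + π/2 + 3π + 2π log(120(4k + 104))/log(7/6)`, there is `T₀ ∈ [2k, 2k + 50]` with
  `θ_k(T₀) ∈ 2πℤ`, i.e. `f(½ + iT₀) > 0` (Stark's Lemma 3, with the window `[2k, 2k+1]` widened to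
  `[2k, 2k+50]`);
* `Literature.Barriers.RiemannHypothesis.exists_starkTheta_neg` — a point `0 < t⋆ < ¼` with
  `θ_k(t⋆) < 0` (Stark: `arg f(½ + i0⁺) = −π/2`).

## References

* [Stark1967EpsteinZeros] §2 (the branch of `arg f`), §3 Lemmas 2–3, §4 (first display).
* [Titchmarsh1986] §9.3–9.4 (Backlund's treatment of `arg ζ`).
* [AndrewsAskeyRoy1999] Thm 1.2.5 (1.2.13) (the series for `ψ`).
-/

noncomputable section

open Complex Filter Topology MeasureTheory Set intervalIntegral Metric

open scoped UpperHalfPlane Real ComplexConjugate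

namespace Literature.Barriers.RiemannHypothesis

open Literature.NumberTheory.Automorphic
open Literature.NumberTheory.LFunctions

/-! ## The continuous argument of `ξ(1 + iV)` -/

/-- **`ϑ_ξ(V) = ∫₀^V Re (ξ'/ξ)(1 + iu) du`**: the continuous argument of `ξ(1 + iV)` (starting from
`arg ξ(1) = 0`), the variation of `arg ξ` along the line `Re w = 1`, where `ξ ≠ 0`.
[cite: Stark1967EpsteinZeros, §2 (the branch of `arg f`)] -/
def xiArg (V : ℝ) : ℝ :=
  ∫ u in (0 : ℝ)..V, (logDeriv riemannXi (1 + u * I)).re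

/-- Unfolding. [folklore] -/
theorem xiArg_def (V : ℝ) : xiArg V = ∫ u in (0 : ℝ)..V, (logDeriv riemannXi (1 + u * I)).re := rfl

/-- Continuity of the integrand `u ↦ ξ'/ξ(1 + iu)`. [folklore] -/
theorem continuous_logDeriv_riemannXi_one_add : Continuous fun u : ℝ ↦ logDeriv riemannXi (1 + u * I) := by
  have := continuous_logDeriv_riemannXi_vertical (c := 1) le_rfl
  simpa using this

/-- `ϑ_ξ(0) = 0`. [folklore] -/
theorem xiArg_zero : xiArg 0 = 0 := by simp [xiArg_def]

/-- `ϑ_ξ` is continuous. [folklore] -/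
theorem continuous_xiArg : Continuous xiArg := by
  have hc : Continuous fun u : ℝ ↦ (logDeriv riemannXi (1 + u * I)).re :=
    Complex.continuous_re.comp continuous_logDeriv_riemannXi_one_add
  unfold xiArg
  exact intervalIntegral.continuous_primitive (fun a b ↦ hc.intervalIntegrable a b) 0

/-- `ϑ_ξ(V₂) − ϑ_ξ(V₁) = ∫_{V₁}^{V₂} Re ξ'/ξ(1 + iu) du`. [folklore] -/
theorem xiArg_sub (V₁ V₂ : ℝ) :
    xiArg V₂ - xiArg V₁ = ∫ u in V₁..V₂, (logDeriv riemannXi (1 + u * I)).re := by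
  have hc : Continuous fun u : ℝ ↦ (logDeriv riemannXi (1 + u * I)).re :=
    Complex.continuous_re.comp continuous_logDeriv_riemannXi_one_add
  rw [xiArg_def, xiArg_def, ← integral_add_adjacent_intervals (hc.intervalIntegrable 0 V₁)
    (hc.intervalIntegrable V₁ V₂)]
  ring

/-- `|ϑ_ξ(V)| ≤ V · sup_{[0,V]} |ξ'/ξ|`-type bound: `|ϑ_ξ(V)| ≤ C V` whenever `‖ξ'/ξ(1+iu)‖ ≤ C` on
`[0, V]`. [folklore] -/
theorem abs_xiArg_le {V C : ℝ} (hV : 0 ≤ V) (hC : ∀ u ∈ Icc 0 V, ‖logDeriv riemannXi (1 + u * I)‖ ≤ C) :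
    |xiArg V| ≤ C * V := by
  rw [xiArg_def]
  have h := intervalIntegral.norm_integral_le_of_norm_le_const (a := 0) (b := V) (C := C)
    (f := fun u : ℝ ↦ (logDeriv riemannXi (1 + u * I)).re) fun u hu ↦ by
      rw [uIoc_of_le hV] at hu
      exact (abs_re_le_norm _).trans (hC u ⟨hu.1.le, hu.2⟩)
  rw [Real.norm_eq_abs, sub_zero, abs_of_nonneg hV] at h
  linarith [h]

/-- **`ξ(1 + iV) = ξ(1) exp(i ∫₀^V ξ'/ξ(1 + iu) du)`**: `ξ` is zero-free and analytic on the
line `Re w = 1`, and `V ↦ ξ(1+iV) e^{−i∫₀^V ξ'/ξ}` has zero derivative. [folklore] -/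
theorem riemannXi_one_add_eq_mul_exp (V : ℝ) :
    riemannXi (1 + V * I) =
      riemannXi 1 * Complex.exp (I * ∫ u in (0 : ℝ)..V, logDeriv riemannXi (1 + u * I)) := by
  set seg : ℝ → ℂ := fun u ↦ 1 + (u : ℂ) * I with hseg
  have hne : ∀ u : ℝ, riemannXi (seg u) ≠ 0 := fun u ↦
    riemannXi_ne_zero_of_one_le_re (by simp [hseg])
  set f : ℝ → ℂ := fun u ↦ logDeriv riemannXi (seg u) with hf
  have hf_cont : Continuous f := continuous_logDeriv_riemannXi_one_add
  set P : ℝ → ℂ := fun τ ↦ ∫ u in (0 : ℝ)..τ, f u with hP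
  have hP_deriv : ∀ τ, HasDerivAt P (f τ) τ := fun τ ↦
    intervalIntegral.integral_hasDerivAt_right (hf_cont.intervalIntegrable _ _)
      (hf_cont.stronglyMeasurableAtFilter _ _) hf_cont.continuousAt
  set G : ℝ → ℂ := fun τ ↦ riemannXi (seg τ) * Complex.exp (-(I * P τ)) with hG
  have hG_deriv : ∀ τ : ℝ, HasDerivAt G 0 τ := by
    intro τ
    have hξ : HasDerivAt (fun τ : ℝ ↦ riemannXi (seg τ)) (deriv riemannXi (seg τ) * I) τ := by
      have hi : HasDerivAt (fun w : ℂ ↦ 1 + w * I) (1 * I) (τ : ℂ) := by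
        simpa using ((hasDerivAt_id (τ : ℂ)).mul_const I).const_add 1
      have h1 := (differentiable_riemannXi (seg τ)).hasDerivAt.comp (τ : ℂ) hi
      rw [one_mul] at h1
      exact h1.comp_ofReal
    have hE : HasDerivAt (fun τ : ℝ ↦ Complex.exp (-(I * P τ))) (Complex.exp (-(I * P τ)) * -(I * f τ)) τ :=
      ((hP_deriv τ).const_mul I).neg.cexp
    have hprod := hξ.mul hE
    have hd : deriv riemannXi (seg τ) = logDeriv riemannXi (seg τ) * riemannXi (seg τ) := by
      rw [logDeriv_apply, div_mul_cancel₀ _ (hne τ)]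
    have hzero : deriv riemannXi (seg τ) * I * Complex.exp (-(I * P τ)) +
        riemannXi (seg τ) * (Complex.exp (-(I * P τ)) * -(I * f τ)) = 0 := by
      rw [hd]; simp only [hf]; ring
    rw [hzero] at hprod
    exact hprod
  have hconst : G V = G 0 := by
    have hdiff : Differentiable ℝ G := fun τ ↦ (hG_deriv τ).differentiableAt
    exact is_const_of_deriv_eq_zero hdiff (fun τ ↦ (hG_deriv τ).deriv) V 0
  have hP0 : P 0 = 0 := by simp [hP]
  have hseg0 : seg 0 = 1 := by simp [hseg]
  simp only [hG, hseg0, hP0, mul_zero, neg_zero, Complex.exp_zero, mul_one] at hconst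
  have hsegV : seg V = 1 + V * I := rfl
  rw [← hsegV, ← hconst, mul_assoc, ← Complex.exp_add, neg_add_cancel, Complex.exp_zero, mul_one]

/-- **Polar form on the line `Re w = 1`: `ξ(1 + iV) = |ξ(1 + iV)| e^{iϑ_ξ(V)}`** (`ξ(1) = ½ > 0`).
[folklore] -/
theorem riemannXi_one_add_eq_norm_mul_exp (V : ℝ) :
    riemannXi (1 + V * I) = ‖riemannXi (1 + V * I)‖ * Complex.exp (xiArg V * I) := by
  have hc : Continuous fun u : ℝ ↦ logDeriv riemannXi (1 + u * I) := continuous_logDeriv_riemannXi_one_add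
  set J : ℂ := ∫ u in (0 : ℝ)..V, logDeriv riemannXi (1 + u * I) with hJ
  have h := riemannXi_one_add_eq_mul_exp V
  rw [← hJ, riemannXi_one] at h
  -- `Im (iJ) = Re J = ϑ_ξ(V)`
  have hre : (I * J).im = xiArg V := by
    rw [mul_im, I_re, I_im, zero_mul, one_mul, zero_add, xiArg_def, hJ]
    have := ContinuousLinearMap.intervalIntegral_comp_comm (𝕜 := ℝ) reCLM (hc.intervalIntegrable (μ := volume) 0 V)
    simpa using this.symm
  -- `exp(iJ) = e^{Re(iJ)} e^{i Im(iJ)}`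
  have hexp : Complex.exp (I * J) = Real.exp ((I * J).re) * Complex.exp (xiArg V * I) := by
    rw [← hre]
    conv_lhs => rw [← re_add_im (I * J)]
    rw [Complex.exp_add, Complex.ofReal_exp]
  rw [h, hexp]
  have hnorm : ‖(1 / 2 : ℂ) * (Real.exp ((I * J).re) * Complex.exp (xiArg V * I))‖ =
      1 / 2 * Real.exp ((I * J).re) := by
    rw [norm_mul, norm_mul, Complex.norm_exp_ofReal_mul_I, mul_one, Complex.norm_real,
      Real.norm_of_nonneg (Real.exp_nonneg _)]
    norm_num
  rw [hnorm]
  push_cast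
  ring

/-! ## The argument `θ_k(t)` of `f(½ + it)` -/

/-- **The continuous argument of `f(½ + it)`**:
`θ_k(t) = t log k + ϑ_ξ(2t) − arg(½ + it) − π/2` (from `f(½+it) = k^{½+it}ξ(1+2it)/((½+it)·2it)`);
`θ_k(0) = −π/2` is Stark's "`arg f(½ + i0⁺) = −π/2`". [cite: Stark1967EpsteinZeros, §2 and §4] -/
def starkTheta (k : ℝ) (t : ℝ) : ℝ :=
  t * Real.log k + xiArg (2 * t) - Complex.arg (1 / 2 + t * I) - π / 2

/-- Unfolding. [folklore] -/
theorem starkTheta_def (k t : ℝ) :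
    starkTheta k t = t * Real.log k + xiArg (2 * t) - Complex.arg (1 / 2 + t * I) - π / 2 := rfl

/-- `θ_k(0) = −π/2`. [cite: Stark1967EpsteinZeros, §4 (first display)] -/
theorem starkTheta_zero (k : ℝ) : starkTheta k 0 = -(π / 2) := by
  have h : Complex.arg (1 / 2 + ((0 : ℝ) : ℂ) * I) = 0 := by
    rw [show (1 / 2 : ℂ) + ((0 : ℝ) : ℂ) * I = ((1 / 2 : ℝ) : ℂ) by push_cast; ring,
      Complex.arg_ofReal_of_nonneg (by norm_num)]
  rw [starkTheta_def, mul_zero, xiArg_zero, h]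
  ring

/-- `½ + it` lies in the slit plane. [folklore] -/
theorem half_add_mem_slitPlane (t : ℝ) : (1 / 2 : ℂ) + t * I ∈ slitPlane := Or.inl (by simp)

/-- `θ_k` is continuous. [folklore] -/
theorem continuous_starkTheta (k : ℝ) : Continuous (starkTheta k) := by
  unfold starkTheta
  refine ((continuous_id.mul continuous_const).add (continuous_xiArg.comp (continuous_const.mul
    continuous_id))).sub ?_ |>.sub continuous_const
  have hf : Continuous fun t : ℝ ↦ (1 / 2 : ℂ) + t * I := by fun_prop
  refine continuous_iff_continuousAt.2 fun t ↦ ?_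
  exact ContinuousAt.comp (g := Complex.arg) (f := fun t : ℝ ↦ (1 / 2 : ℂ) + t * I)
    (Complex.continuousAt_arg (half_add_mem_slitPlane t)) hf.continuousAt

/-- `0 ≤ arg(½ + it) ≤ π/2` for `t ≥ 0`. [folklore] -/
theorem arg_half_add_mem {t : ℝ} (ht : 0 ≤ t) : Complex.arg (1 / 2 + t * I) ∈ Icc 0 (π / 2) := by
  constructor
  · rw [Complex.arg_nonneg_iff]; simpa using ht
  · have h := (Complex.abs_arg_le_pi_div_two_iff (z := 1 / 2 + t * I)).2 (by simp)
    exact (le_abs_self _).trans h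

/-- **Polar form of `f` on the critical line**: for `t > 0`,
`f(½ + it) = |f(½ + it)| e^{iθ_k(t)}` (`k = Im z`). [cite: Stark1967EpsteinZeros, §2 and §4] -/
theorem starkF_critical_eq_norm_mul_exp (z : ℍ) {t : ℝ} (ht : 0 < t) :
    starkF z (1 / 2 + t * I) =
      ‖starkF z (1 / 2 + t * I)‖ * Complex.exp (starkTheta z.im t * I) := by
  have hy := z.im_pos
  set k := z.im with hk
  set s : ℂ := 1 / 2 + t * I with hs
  -- the unit exponentials `e(x) = e^{ix}`
  set e : ℝ → ℂ := fun x ↦ Complex.exp (x * I) with he_def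
  have he : ∀ a b : ℝ, e a * e b = e (a + b) := fun a b ↦ by
    simp only [he_def]; rw [← Complex.exp_add]; push_cast; ring_nf
  have he1 : ∀ a : ℝ, ‖e a‖ = 1 := fun a ↦ by simp only [he_def]; exact Complex.norm_exp_ofReal_mul_I a
  have hs0 : s ≠ 0 := fun h ↦ by
    have := congrArg Complex.re h; simp [hs] at this
  have h2s0 : 2 * s ≠ 0 := mul_ne_zero two_ne_zero hs0
  have h2s1 : 2 * s ≠ 1 := fun h ↦ by
    have := congrArg Complex.im h; simp [hs] at this; exact ht.ne' this
  have hw : 2 * s = 1 + ((2 * t : ℝ) : ℂ) * I := by rw [hs]; push_cast; ring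
  have hnorm_s : 0 < ‖s‖ := norm_pos_iff.2 hs0
  have hξ0 : 0 < ‖riemannXi (2 * s)‖ :=
    norm_pos_iff.2 (riemannXi_ne_zero_of_one_le_re (by rw [hw]; simp))
  -- (E1) `f(s) · (2s)(2s−1) = 2 k^s ξ(2s)`
  set D : ℂ := 2 * s * (2 * s - 1) with hD
  have hD0 : D ≠ 0 := mul_ne_zero h2s0 (sub_ne_zero.2 h2s1)
  have E1 : starkF z s * D = 2 * (((k : ℝ) : ℂ) ^ s * riemannXi (2 * s)) := by
    rw [starkF_def, ← hk, riemannXi_eq_mul_completedRiemannZeta h2s0 h2s1, hD]; ring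
  -- (E2)–(E5) polar forms
  have hks : ((k : ℝ) : ℂ) ^ s = Real.sqrt k * e (t * Real.log k) := by
    have hkc : ((k : ℝ) : ℂ) ≠ 0 := by exact_mod_cast hy.ne'
    simp only [he_def]
    rw [Complex.cpow_def_of_ne_zero hkc, ← Complex.ofReal_log hy.le, hs,
      Real.sqrt_eq_rpow, Complex.ofReal_cpow hy.le, Complex.cpow_def_of_ne_zero hkc,
      ← Complex.ofReal_log hy.le, ← Complex.exp_add]
    congr 1
    push_cast
    ring
  have hξ : riemannXi (2 * s) = ‖riemannXi (2 * s)‖ * e (xiArg (2 * t)) := by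
    simp only [he_def]; rw [hw]; exact riemannXi_one_add_eq_norm_mul_exp (2 * t)
  have hDe : D = ((4 * t * ‖s‖ : ℝ) : ℂ) * e (Complex.arg s + π / 2) := by
    have hsp : s = ‖s‖ * e (Complex.arg s) := by
      simp only [he_def]; exact (Complex.norm_mul_exp_arg_mul_I s).symm
    have hIe : I = e (π / 2) := by
      simp only [he_def]; push_cast; exact (Complex.exp_pi_div_two_mul_I).symm
    have h1 : D = 4 * (t : ℂ) * (I * s) := by rw [hD, hs]; ring
    rw [h1]
    conv_lhs => rw [hsp, hIe]
    rw [show 4 * (t : ℂ) * (e (π / 2) * (↑‖s‖ * e (Complex.arg s))) =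
      ((4 * t * ‖s‖ : ℝ) : ℂ) * (e (Complex.arg s) * e (π / 2)) by push_cast; ring, he]
  -- the modulus `r = √k |ξ(2s)| / (2t |s|)` and the two scalar identities
  set r : ℝ := Real.sqrt k * ‖riemannXi (2 * s)‖ / (2 * t * ‖s‖) with hr
  have hr0 : 0 < r := by rw [hr]; have := Real.sqrt_pos.2 hy; positivity
  have hr_eq : r * (4 * t * ‖s‖) = 2 * Real.sqrt k * ‖riemannXi (2 * s)‖ := by
    rw [hr]; field_simp; ring
  have hθ_eq : starkTheta k t + (Complex.arg s + π / 2) = t * Real.log k + xiArg (2 * t) := by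
    rw [starkTheta_def, ← hs]; ring
  -- `r e(θ) D = 2 k^s ξ(2s)`
  have E6 : (r : ℂ) * e (starkTheta k t) * D = 2 * (((k : ℝ) : ℂ) ^ s * riemannXi (2 * s)) := by
    rw [hDe, hks, hξ]
    calc (r : ℂ) * e (starkTheta k t) * (((4 * t * ‖s‖ : ℝ) : ℂ) * e (Complex.arg s + π / 2))
        = ((r * (4 * t * ‖s‖) : ℝ) : ℂ) * (e (starkTheta k t) * e (Complex.arg s + π / 2)) := by
          push_cast; ring
      _ = ((2 * Real.sqrt k * ‖riemannXi (2 * s)‖ : ℝ) : ℂ) * e (t * Real.log k + xiArg (2 * t)) := by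
          rw [he, hr_eq, hθ_eq]
      _ = 2 * (↑(Real.sqrt k) * e (t * Real.log k) * (↑‖riemannXi (2 * s)‖ * e (xiArg (2 * t)))) := by
          rw [← he]; push_cast; ring
  -- cancel `D`
  have key : starkF z s = (r : ℂ) * e (starkTheta k t) := by
    apply mul_right_cancel₀ hD0
    rw [E1, E6]
  have hnorm : ‖starkF z s‖ = r := by
    rw [key, norm_mul, he1, mul_one, Complex.norm_real, Real.norm_of_nonneg hr0.le]
  rw [hnorm, key]

/-! ## The real part of `ξ'/ξ` on `Re w = 1` is bounded below, up to the variation of `arg ζ` -/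

/-- **`Re ψ(x + iu) ≥ Re ψ(x)` for `x > 0`** (the series `ψ(w) + γ = Σ (1/(k+1) − 1/(w+k))`,
Andrews–Askey–Roy (1.2.13): termwise `Re(1/(x+k)) − Re(1/(x+k+iu)) = u²/((x+k)((x+k)²+u²)) ≥ 0`).
[cite: AndrewsAskeyRoy1999, Thm 1.2.5 (1.2.13)] -/
theorem re_digamma_ofReal_le_re_digamma {x : ℝ} (hx : 0 < x) (u : ℝ) :
    (Complex.digamma x).re ≤ (Complex.digamma (x + u * I)).re := by
  have h1 := Literature.Analysis.SpecialFunctions.Complex.hasSum_one_div_sub_one_div_digamma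
    (w := (x : ℂ) + u * I) (by simpa using hx)
  have h0 := Literature.Analysis.SpecialFunctions.Complex.hasSum_one_div_sub_one_div_digamma
    (w := (x : ℂ)) (by simpa using hx)
  have h := (h1.sub h0).mapL Complex.reCLM
  simp only [Complex.reCLM_apply, sub_re, add_re, ofReal_re] at h
  have hlim : (Complex.digamma ((x : ℂ) + u * I)).re + Real.eulerMascheroniConstant -
      ((Complex.digamma (x : ℂ)).re + Real.eulerMascheroniConstant) =
      (Complex.digamma ((x : ℂ) + u * I)).re - (Complex.digamma (x : ℂ)).re := by ring
  rw [hlim] at h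
  have hnn : ∀ k : ℕ, 0 ≤ (1 / ((k : ℂ) + 1)).re - (1 / ((x : ℂ) + u * I + k)).re -
      ((1 / ((k : ℂ) + 1)).re - (1 / ((x : ℂ) + k)).re) := by
    intro k
    have e : (1 / ((k : ℂ) + 1)).re - (1 / ((x : ℂ) + u * I + k)).re -
        ((1 / ((k : ℂ) + 1)).re - (1 / ((x : ℂ) + k)).re) =
        (1 / ((x : ℂ) + k)).re - (1 / ((x : ℂ) + u * I + k)).re := by ring
    rw [e]
    have hxk : 0 < x + k := by positivity
    have hA : (1 / ((x : ℂ) + k)).re = 1 / (x + k) := by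
      rw [show (x : ℂ) + k = ((x + k : ℝ) : ℂ) by push_cast; ring, ← Complex.ofReal_one,
        ← Complex.ofReal_div, Complex.ofReal_re]
    have hB : (1 / ((x : ℂ) + u * I + k)).re = (x + k) / ((x + k) ^ 2 + u ^ 2) := by
      rw [show (x : ℂ) + u * I + k = ((x + k : ℝ) : ℂ) + u * I by push_cast; ring, one_div, Complex.inv_re]
      simp [Complex.normSq_apply]
      ring_nf
    rw [hA, hB, sub_nonneg, div_le_div_iff₀ (by positivity) hxk]
    nlinarith [sq_nonneg u]
  have := h.nonneg hnn
  linarith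

/-- **`Re Γℝ'/Γℝ(1 + iv) ≥ −8/5`**: `Γℝ'/Γℝ(w) = −½ log π + ½ ψ(w/2)` and
`Re ψ(½ + iv/2) ≥ ψ(½) ≥ log ½ − 1 − ⅓`. [folklore] -/
theorem re_logDeriv_Gammaℝ_one_add_ge (v : ℝ) : -(8 / 5) ≤ (logDeriv Gammaℝ (1 + v * I)).re := by
  have hne : ∀ m : ℕ, (1 + (v : ℂ) * I) / 2 ≠ -m := fun m h ↦ by
    have := congrArg Complex.re h; simp at this; linarith [(m.cast_nonneg : (0 : ℝ) ≤ m)]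
  rw [Literature.NumberTheory.LFunctions.logDeriv_Gammaℝ hne, add_re]
  have h1 : (-(Complex.log π) / 2).re = -(Real.log π) / 2 := by
    rw [Complex.div_ofNat_re, Complex.neg_re, ← Complex.ofReal_log Real.pi_pos.le, Complex.ofReal_re]
  have h2 : (Complex.digamma ((1 + (v : ℂ) * I) / 2) / 2).re = (Complex.digamma ((1 / 2 : ℝ) + (v / 2 : ℝ) * I)).re / 2 := by
    rw [Complex.div_ofNat_re]
    congr 3
    push_cast; ring
  rw [h1, h2]
  have hψ := re_digamma_ofReal_le_re_digamma (x := 1 / 2) (by norm_num) (v / 2)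
  have hψ0 := Literature.Analysis.SpecialFunctions.Real.log_sub_le_re_digamma (x := 1 / 2) (by norm_num)
  have hlog2 : Real.log (1 / 2) = -Real.log 2 := by rw [one_div, Real.log_inv]
  rw [hlog2] at hψ0
  have hl2 := Real.log_two_lt_d9
  have hlπ := Literature.Analysis.SpecialFunctions.Real.log_pi_le
  push_cast at hψ ⊢
  norm_num at hψ0
  linarith

/-- **`Re ξ'/ξ(1 + iv) ≥ −8/5 + Re ζ'/ζ(1 + iv)`** (`v ≠ 0`): `ξ'/ξ = 1/w + 1/(w−1) + Γℝ'/Γℝ + ζ'/ζ`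
with `Re(1/w) ≥ 0`, `Re(1/(w−1)) = 0` on `Re w = 1`. [folklore] -/
theorem re_logDeriv_riemannXi_one_add_ge {v : ℝ} (hv : v ≠ 0) :
    -(8 / 5) + (deriv riemannZeta (1 + v * I) / riemannZeta (1 + v * I)).re ≤
      (logDeriv riemannXi (1 + v * I)).re := by
  have hw1 : (1 : ℂ) + v * I ≠ 1 := fun h ↦ hv (by simpa using congrArg Complex.im h)
  have hζ : riemannZeta (1 + v * I) ≠ 0 := riemannZeta_ne_zero_of_one_le_re (by simp)
  rw [logDeriv_apply, logDeriv_riemannXi_eq_add_logDeriv_riemannZeta (by simp) hw1 hζ]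
  simp only [add_re]
  have h1 : 0 ≤ ((1 + (v : ℂ) * I)⁻¹).re := by
    rw [Complex.inv_re]; apply div_nonneg (by simp) (Complex.normSq_nonneg _)
  have h2 : ((1 + (v : ℂ) * I - 1)⁻¹).re = 0 := by simp
  have h3 := re_logDeriv_Gammaℝ_one_add_ge v
  linarith

/-! ## The variation of `arg ζ` along `Re w = 1` -/

/-- Backlund's bound on `[1, 2] × {T}` (the tree's `Literature.NumberTheory.LFunctions.abs_im_integral_logDeriv_riemannZeta_horizontal_le`
restricted to `[1, 2]`, where `ζ ≠ 0` automatically): for `T ≥ 2`,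
`|Im ∫₁² ζ'/ζ(x+iT) dx| ≤ π (log(120 (T+4))/log(7/6) + 1)`. [cite: Titchmarsh1986, Thm. 9.4] -/
theorem abs_im_integral_logDeriv_riemannZeta_horizontal_one_two {T : ℝ} (hT : 2 ≤ T) :
    |(∫ x in (1 : ℝ)..2, deriv riemannZeta (x + T * I) / riemannZeta (x + T * I)).im| ≤
      π * (Real.log (120 * (T + 4)) / Real.log (7 / 6) + 1) := by
  have hT' : 2 ≤ |T| := by rwa [abs_of_nonneg (by linarith)]
  have hTabs : |T| = T := abs_of_nonneg (by linarith)
  have hM : (1 : ℝ) ≤ 40 * (T + 4) := by linarith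
  have hsub : closedBall ((2 : ℂ) + T * I) (7 / 4) ⊆ closedBall ((2 : ℂ) + T * I) (39 / 20) :=
    closedBall_subset_closedBall (by norm_num)
  have hg : ∀ z ∈ closedBall (((2 : ℝ) : ℂ) + T * I) (7 / 4), AnalyticAt ℂ riemannZeta z := by
    intro z hz
    simp only [ofReal_ofNat] at hz
    exact Literature.NumberTheory.LFunctions.analyticOnNhd_riemannZeta_jensenDisc hT' (by norm_num) z hz
  have hgM : ∀ z ∈ closedBall (((2 : ℝ) : ℂ) + T * I) (7 / 4), ‖riemannZeta z‖ ≤ 40 * (T + 4) := by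
    intro z hz
    simp only [ofReal_ofNat] at hz
    have := Literature.NumberTheory.LFunctions.norm_riemannZeta_le_of_mem_jensenDisc hT' (hsub hz)
    rwa [hTabs] at this
  have hc : riemannZeta ((2 : ℝ) + T * I) ≠ 0 := by
    simpa using Literature.NumberTheory.LFunctions.riemannZeta_two_add_ne_zero T
  have hζ : ∀ x ∈ Icc (1 : ℝ) 2, riemannZeta (x + T * I) ≠ 0 := fun x hx ↦
    riemannZeta_ne_zero_of_one_le_re (by simpa using hx.1)
  have h := Literature.Analysis.Complex.abs_im_integral_logDeriv_le_backlund (g := riemannZeta) (c := 2) (y := T)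
    (r := 3 / 2) (R := 7 / 4) (M := 40 * (T + 4)) (a := 1) (b := 2) (by norm_num) (by norm_num)
    hM hg hgM hc (by norm_num) (by norm_num) (by norm_num) hζ
  refine h.trans ?_
  have hlog76 : 0 < Real.log (7 / 4 / (3 / 2)) := Real.log_pos (by norm_num)
  have hnorm : 1 / 3 ≤ ‖riemannZeta ((2 : ℝ) + T * I)‖ := by
    simpa using Literature.NumberTheory.LFunctions.one_third_le_norm_riemannZeta_two_add T
  have hpos : 0 < ‖riemannZeta ((2 : ℝ) + T * I)‖ := by linarith
  have h1 : Real.log (40 * (T + 4) / ‖riemannZeta ((2 : ℝ) + T * I)‖) ≤ Real.log (120 * (T + 4)) := by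
    apply Real.log_le_log (div_pos (by linarith) hpos)
    rw [div_le_iff₀ hpos]
    nlinarith
  have h2 : (7 : ℝ) / 4 / (3 / 2) = 7 / 6 := by norm_num
  rw [h2] at hlog76 ⊢
  have := div_le_div_of_nonneg_right h1 hlog76.le
  nlinarith [Real.pi_pos]

/-- **The variation of `arg ζ(1 + iv)` over `[V₁, V₂]` is `O(log V₂)`**: for `2 ≤ V₁ ≤ V₂`,
`|∫_{V₁}^{V₂} Re ζ'/ζ(1+iv) dv| ≤ 3π + 2π log(120 (V₂+4))/log(7/6)` — Cauchy's theorem for `ζ'/ζ` on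
`[1,2] × [V₁,V₂]` moves the path to `Re w = 2` (where `|arg ζ| < π/2`) at the cost of two
horizontal segments bounded by Backlund's lemma. [cite: Titchmarsh1986, §9.3–9.4] -/
theorem abs_integral_re_logDeriv_riemannZeta_one_le {V₁ V₂ : ℝ} (h2 : 2 ≤ V₁) (h12 : V₁ ≤ V₂) :
    |∫ v in V₁..V₂, (deriv riemannZeta (1 + v * I) / riemannZeta (1 + v * I)).re| ≤
      3 * π + 2 * π * (Real.log (120 * (V₂ + 4)) / Real.log (7 / 6)) := by
  have hV₂ : 2 ≤ V₂ := h2.trans h12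
  -- `ζ'/ζ` is holomorphic on the closed rectangle `[1,2] × [V₁,V₂]`
  have hpt : ∀ w : ℂ, 1 ≤ w.re → V₁ ≤ w.im →
      w ≠ 1 ∧ riemannZeta w ≠ 0 := fun w hwre hwim ↦
    ⟨fun h ↦ by rw [h] at hwim; simp at hwim; linarith, riemannZeta_ne_zero_of_one_le_re hwre⟩
  have hdiffAt : ∀ w : ℂ, 1 ≤ w.re → V₁ ≤ w.im →
      DifferentiableAt ℂ (fun w ↦ deriv riemannZeta w / riemannZeta w) w := by
    intro w hwre hwim
    obtain ⟨hw1, hζ⟩ := hpt w hwre hwim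
    exact (analyticOn_riemannZeta w hw1).deriv.differentiableAt.div (differentiableAt_riemannZeta hw1) hζ
  have hdiff : DifferentiableOn ℂ (fun w ↦ deriv riemannZeta w / riemannZeta w)
      (Icc (1 : ℝ) 2 ×ℂ Icc V₁ V₂) := fun w hw ↦
    (hdiffAt w hw.1.1 hw.2.1).differentiableWithinAt
  have hrect := Literature.Analysis.Complex.rectBoundaryIntegral_eq_zero_of_differentiableOn
    (F := fun w ↦ deriv riemannZeta w / riemannZeta w) (by norm_num : (1 : ℝ) ≤ 2) h12 hdiff
  simp only [Literature.Analysis.Complex.rectBoundaryIntegral_def] at hrect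
  -- the left edge in terms of the other three
  have hleft : I * (∫ v : ℝ in V₁..V₂, deriv riemannZeta ((1 : ℝ) + v * I) / riemannZeta ((1 : ℝ) + v * I)) =
      (∫ x : ℝ in (1 : ℝ)..2, deriv riemannZeta (x + V₁ * I) / riemannZeta (x + V₁ * I)) -
        (∫ x : ℝ in (1 : ℝ)..2, deriv riemannZeta (x + V₂ * I) / riemannZeta (x + V₂ * I)) +
        I * (∫ v : ℝ in V₁..V₂, deriv riemannZeta ((2 : ℝ) + v * I) / riemannZeta ((2 : ℝ) + v * I)) := by
    linear_combination -hrect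
  -- `∫ Re = Re ∫ = Im (I ∫)`
  have hcont : ContinuousOn (fun v : ℝ ↦ deriv riemannZeta ((1 : ℝ) + v * I) / riemannZeta ((1 : ℝ) + v * I))
      (uIcc V₁ V₂) := by
    intro v hv
    rw [uIcc_of_le h12] at hv
    refine ContinuousAt.continuousWithinAt ?_
    have h := (hdiffAt ((1 : ℝ) + v * I) (by simp) (by simpa using hv.1)).continuousAt
    exact h.comp (f := fun v : ℝ ↦ ((1 : ℝ) : ℂ) + v * I) (by fun_prop)
  have hint := hcont.intervalIntegrable (μ := volume)
  have hre : (∫ v in V₁..V₂, (deriv riemannZeta (1 + v * I) / riemannZeta (1 + v * I)).re) =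
      (I * ∫ v : ℝ in V₁..V₂, deriv riemannZeta ((1 : ℝ) + v * I) / riemannZeta ((1 : ℝ) + v * I)).im := by
    rw [mul_im, I_re, I_im, zero_mul, one_mul, zero_add]
    have := ContinuousLinearMap.intervalIntegral_comp_comm (𝕜 := ℝ) reCLM hint
    simpa using this
  rw [hre, hleft]
  -- the three bounds
  have hbot := abs_im_integral_logDeriv_riemannZeta_horizontal_one_two h2
  have htop := abs_im_integral_logDeriv_riemannZeta_horizontal_one_two hV₂
  have hvert : |(I * ∫ v : ℝ in V₁..V₂, deriv riemannZeta ((2 : ℝ) + v * I) /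
      riemannZeta ((2 : ℝ) + v * I)).im| ≤ π := by
    have hne1 : ∀ y : ℝ, ((2 : ℝ) : ℂ) + y * I ≠ 1 := fun y h ↦ by
      have := congrArg Complex.re h; norm_num at this
    have han : ∀ y ∈ Icc V₁ V₂, AnalyticAt ℂ riemannZeta ((2 : ℝ) + y * I) := fun y _ ↦
      analyticOn_riemannZeta _ (hne1 y)
    have hslit : ∀ y ∈ Icc V₁ V₂, riemannZeta ((2 : ℝ) + y * I) ∈ slitPlane := fun y _ ↦
      Or.inl (by simpa using re_riemannZeta_two_add_pos y)
    have h := Literature.Analysis.Complex.integral_logDeriv_vertical (g := riemannZeta) 2 h12 han hslit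
    rw [h, sub_im, log_im, log_im]
    have a1 := abs_arg_le_pi_div_two_iff.2 (by simpa using (re_riemannZeta_two_add_pos V₂).le :
      0 ≤ (riemannZeta ((2 : ℝ) + V₂ * I)).re)
    have a2 := abs_arg_le_pi_div_two_iff.2 (by simpa using (re_riemannZeta_two_add_pos V₁).le :
      0 ≤ (riemannZeta ((2 : ℝ) + V₁ * I)).re)
    have := abs_sub (arg (riemannZeta ((2 : ℝ) + V₂ * I))) (arg (riemannZeta ((2 : ℝ) + V₁ * I)))
    linarith
  -- monotonicity of the logarithmic term
  have hL : Real.log (120 * (V₁ + 4)) / Real.log (7 / 6) ≤ Real.log (120 * (V₂ + 4)) / Real.log (7 / 6) := by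
    apply div_le_div_of_nonneg_right _ (Real.log_pos (by norm_num)).le
    exact Real.log_le_log (by linarith) (by linarith)
  rw [add_im, sub_im]
  have e := abs_add_le ((∫ x : ℝ in (1 : ℝ)..2, deriv riemannZeta (x + V₁ * I) / riemannZeta (x + V₁ * I)).im -
    (∫ x : ℝ in (1 : ℝ)..2, deriv riemannZeta (x + V₂ * I) / riemannZeta (x + V₂ * I)).im)
    (I * ∫ v : ℝ in V₁..V₂, deriv riemannZeta ((2 : ℝ) + v * I) / riemannZeta ((2 : ℝ) + v * I)).im
  have e2 := abs_sub ((∫ x : ℝ in (1 : ℝ)..2, deriv riemannZeta (x + V₁ * I) / riemannZeta (x + V₁ * I)).im)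
    ((∫ x : ℝ in (1 : ℝ)..2, deriv riemannZeta (x + V₂ * I) / riemannZeta (x + V₂ * I)).im)
  have hπ := Real.pi_pos
  have hL0 : 0 ≤ Real.log (120 * (V₁ + 4)) / Real.log (7 / 6) :=
    div_nonneg (Real.log_nonneg (by linarith)) (Real.log_pos (by norm_num)).le
  nlinarith

/-! ## The increase of `θ_k` and the choice of `T₀` -/

/-- **The increase of the argument** (the substitute for Stark's Lemmas 2–3): for `2 ≤ T₁ ≤ T₂`,
`θ_k(T₂) − θ_k(T₁) ≥ (T₂ − T₁)(log k − 16/5) − π/2 − 3π − 2π log(120 (2T₂+4))/log(7/6)`.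
[cite: Stark1967EpsteinZeros, §3 Lemmas 2–3] -/
theorem starkTheta_sub_ge (k : ℝ) {T₁ T₂ : ℝ} (h2 : 2 ≤ T₁) (h12 : T₁ ≤ T₂) :
    (T₂ - T₁) * (Real.log k - 16 / 5) - π / 2 - (3 * π + 2 * π * (Real.log (120 * (2 * T₂ + 4)) /
      Real.log (7 / 6))) ≤ starkTheta k T₂ - starkTheta k T₁ := by
  have hc : Continuous fun u : ℝ ↦ (logDeriv riemannXi (1 + u * I)).re :=
    Complex.continuous_re.comp continuous_logDeriv_riemannXi_one_add
  -- the `ξ` part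
  have hξ : (2 * T₂ - 2 * T₁) * (-(8 / 5)) - (3 * π + 2 * π * (Real.log (120 * (2 * T₂ + 4)) /
      Real.log (7 / 6))) ≤ xiArg (2 * T₂) - xiArg (2 * T₁) := by
    rw [xiArg_sub]
    have h4 : 2 ≤ 2 * T₁ := by linarith
    have h412 : 2 * T₁ ≤ 2 * T₂ := by linarith
    have hζb := abs_integral_re_logDeriv_riemannZeta_one_le h4 h412
    -- pointwise lower bound, integrated
    have hcontζ : ContinuousOn (fun v : ℝ ↦ (deriv riemannZeta (1 + v * I) / riemannZeta (1 + v * I)).re)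
        (Icc (2 * T₁) (2 * T₂)) := by
      intro v hv
      have hv0 : 0 < v := by linarith [hv.1]
      have hw1 : (1 : ℂ) + v * I ≠ 1 := fun h ↦ hv0.ne' (by simpa using congrArg Complex.im h)
      have hζ : riemannZeta (1 + v * I) ≠ 0 := riemannZeta_ne_zero_of_one_le_re (by simp)
      have hd : ContinuousAt (fun w : ℂ ↦ deriv riemannZeta w / riemannZeta w) (1 + v * I) :=
        ((analyticOn_riemannZeta _ hw1).deriv.differentiableAt.div (differentiableAt_riemannZeta hw1)
          hζ).continuousAt
      exact (Complex.continuous_re.continuousAt.comp (hd.comp (f := fun v : ℝ ↦ (1 : ℂ) + v * I)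
        (by fun_prop))).continuousWithinAt
    have hmono := intervalIntegral.integral_mono_on (μ := volume) h412
      ((continuousOn_const.add hcontζ).intervalIntegrable_of_Icc (μ := volume) h412)
      (hc.continuousOn.intervalIntegrable_of_Icc (μ := volume) h412)
      (fun v hv ↦ re_logDeriv_riemannXi_one_add_ge (v := v) (by linarith [hv.1] : v ≠ 0))
    simp only [Pi.add_apply] at hmono
    rw [intervalIntegral.integral_add ((continuousOn_const (c := (-(8 / 5) : ℝ))).intervalIntegrable_of_Icc
      (μ := volume) h412) (hcontζ.intervalIntegrable_of_Icc (μ := volume) h412),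
      intervalIntegral.integral_const, smul_eq_mul] at hmono
    have habs := (abs_le.1 hζb).1
    nlinarith
  -- the `arg` part
  have ha₁ := arg_half_add_mem (t := T₁) (by linarith)
  have ha₂ := arg_half_add_mem (t := T₂) (by linarith)
  rw [starkTheta_def, starkTheta_def]
  nlinarith [ha₁.1, ha₁.2, ha₂.1, ha₂.2]

/-- **The height `T₀` (Stark's Lemma 3, widened window)**: if
`50 (log k − 16/5) ≥ 2π + π/2 + 3π + 2π log(120 (4k + 104))/log(7/6)` (true for `k` large) and
`k ≥ 1`, there is `T₀ ∈ [2k, 2k + 50]` with `θ_k(T₀) = 2πm`, `m ∈ ℤ`, i.e. `f(½ + iT₀)` real and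
positive. [cite: Stark1967EpsteinZeros, §3 Lemma 3] -/
theorem exists_starkT₀ {k : ℝ} (hk : 1 ≤ k)
    (hlarge : 2 * π + π / 2 + (3 * π + 2 * π * (Real.log (120 * (2 * (2 * k + 50) + 4)) /
      Real.log (7 / 6))) ≤ 50 * (Real.log k - 16 / 5)) :
    ∃ T₀ ∈ Icc (2 * k) (2 * k + 50), ∃ m : ℤ, starkTheta k T₀ = 2 * π * m := by
  have hinc := starkTheta_sub_ge k (T₁ := 2 * k) (T₂ := 2 * k + 50) (by linarith) (by linarith)
  have h2π : starkTheta k (2 * k) + 2 * π ≤ starkTheta k (2 * k + 50) := by nlinarith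
  set m : ℤ := ⌈starkTheta k (2 * k) / (2 * π)⌉ with hm
  have hπ := Real.pi_pos
  have hm1 : starkTheta k (2 * k) ≤ 2 * π * m := by
    have := Int.le_ceil (starkTheta k (2 * k) / (2 * π))
    rw [div_le_iff₀ (by positivity)] at this
    linarith
  have hm2 : 2 * π * m ≤ starkTheta k (2 * k) + 2 * π := by
    have := Int.ceil_lt_add_one (starkTheta k (2 * k) / (2 * π))
    have h' : (m : ℝ) * (2 * π) < (starkTheta k (2 * k) / (2 * π) + 1) * (2 * π) :=
      mul_lt_mul_of_pos_right this (by positivity)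
    rw [add_mul, div_mul_cancel₀ _ (by positivity)] at h'
    linarith
  have hmem : 2 * π * (m : ℝ) ∈ Icc (starkTheta k (2 * k)) (starkTheta k (2 * k + 50)) :=
    ⟨hm1, by linarith⟩
  obtain ⟨T₀, hT₀, hval⟩ := intermediate_value_Icc (by linarith : 2 * k ≤ 2 * k + 50)
    (continuous_starkTheta k).continuousOn hmem
  exact ⟨T₀, hT₀, m, hval⟩

/-- **A point where the argument is still negative** (Stark: `arg f(½ + i0⁺) = −π/2`): for
`k ≥ 1` there is `0 < t⋆ < ¼` with `θ_k(t⋆) < 0`. [cite: Stark1967EpsteinZeros, §4 (first display)] -/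
theorem exists_starkTheta_neg {k : ℝ} (hk : 1 ≤ k) :
    ∃ t : ℝ, 0 < t ∧ t < 1 / 4 ∧ starkTheta k t < 0 := by
  -- a bound for `ξ'/ξ` on `[1, 1 + i]`
  obtain ⟨C₀, hC₀⟩ := isCompact_Icc.exists_bound_of_continuousOn
    (continuous_logDeriv_riemannXi_one_add.continuousOn (s := Icc (0 : ℝ) 1))
  set C := max C₀ 0 with hC
  have hC0 : 0 ≤ C := le_max_right _ _
  have hCb : ∀ u ∈ Icc (0 : ℝ) 1, ‖logDeriv riemannXi (1 + u * I)‖ ≤ C := fun u hu ↦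
    (hC₀ u hu).trans (le_max_left _ _)
  have hlog : 0 ≤ Real.log k := Real.log_nonneg hk
  set t : ℝ := 1 / (Real.log k + 2 * C + 8) with ht
  have hden : 0 < Real.log k + 2 * C + 8 := by positivity
  have ht0 : 0 < t := by rw [ht]; positivity
  have ht4 : t < 1 / 4 := by
    rw [ht, div_lt_div_iff_of_pos_left one_pos hden (by norm_num)]; linarith
  refine ⟨t, ht0, ht4, ?_⟩
  have hxi : |xiArg (2 * t)| ≤ C * (2 * t) :=
    abs_xiArg_le (by linarith) fun u hu ↦ hCb u ⟨hu.1, hu.2.trans (by linarith)⟩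
  have harg := (arg_half_add_mem ht0.le).1
  have hprod : t * (Real.log k + 2 * C) < 1 := by
    have : t * (Real.log k + 2 * C + 8) = 1 := by rw [ht]; field_simp
    nlinarith
  rw [starkTheta_def]
  have hπ := Real.pi_gt_three
  have := (abs_le.1 hxi).2
  nlinarith

end Literature.Barriers.RiemannHypothesis
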